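import Literature.Probability.FitznerVanDerHofstad2017.NobleBoundsN1XSpace
import Literature.Probability.FitznerVanDerHofstad2017.NobleBlocksPercSupport
import HarnessLib

/-!
# [FvdH17] (6.5) at `N = 1` with the class-`1̲`-AVERAGED middle element of §6.1 p. 59, PROVED

[FvdH17] = R. Fitzner, R. van der Hofstad, *Mean-field behavior for nearest-neighbor percolation in `d > 10`*,
Electron. J. Probab. **22** (2017), no. 43, arXiv:1506.07977v2.  §6.1 p. 59: "When `a = 1` and/or `b = 1`, we
include the information that either `u, w` and/or `z, t` are neighbors into the definition of `Ā^{ι,a,b}(u,w,z,t)`."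
— i.e. in the classes `1̲` the matrix element of `Ā^ι` in (6.5) may be taken as the AVERAGE over the `2d` unit
offsets instead of the supremum over all offsets (`BlockSummation.matAbarAvg`, module `BlockSummationAvg`).

This module combines the kernel-proved `x`-space bound (6.4) `NobleBoundsN1XSpace.nobleXiT_one_le_blocks` with the
percolation instance of the class-averaged summation `NobleBlocks.tsum_le_vecPS_matAbarAvg'_vecPE_perc` (support,
flank constancy and translation invariance all discharged in `NobleBlocksPercSupport` / `NobleBlocksCov`):
`Σ_x Ξ^{(1)}_p(x) ≤ P⃗^S · Ā'_{avg} · P⃗^E` with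
`Ā'_{avg} = matAbarAvg (unitVecs d) (· = 1) (blockAbar' (Letters.perc d p))`, for every `p` and every `d`.
Since `matAbarAvg ≤ matAbar` entrywise (`BlockSummation.matAbarAvg_le_matAbar`), this sharpens
`NobleBoundsN1XSpace.tsum_nobleXiT_one_le`.  No named fact, no numeral, no dimension is fixed.
-/

noncomputable section

namespace Literature.Probability.FitznerVanDerHofstad2017

open _root_.MeasureTheory Literature.Barriers.CriticalPhenomena Literature.Probability.Percolation
open Literature.Probability.LatticeModels
open Literature.Probability.FitznerVanDerHofstad2017.NobleBlocks
open Literature.Probability.FitznerVanDerHofstad2017.BlockSummation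
open scoped ENNReal Matrix

variable {d : ℕ}

/-- **[FvdH17] (6.5) at `N = 1`, class-`1̲`-averaged form**:
`Σ_x Ξ^{(1)}_p(x) ≤ P⃗^S ᵥ* Ā'_{avg} ⬝ᵥ P⃗^E`, the class-`1` in- and out-offsets of `Ā'` averaged over the unit vectors.
[cite: FitznerVanDerHofstad2017, Lemma 5.2 first display / §6.1 (6.5) with p. 59 "we include the information that … are neighbors" (arXiv:1506.07977v2 pp. 50, 58–59)] -/
theorem tsum_nobleXiT_one_le_avg (p : unitInterval) :
    ∑' x, nobleXiT d p 1 x ≤ vecPS (Letters.perc d p) ᵥ*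
      matAbarAvg (unitVecs d) (fun a : Fin 3 => decide (a = 1)) (blockAbar' (Letters.perc d p)) ⬝ᵥ
        vecPE (Letters.perc d p) :=
  tsum_le_vecPS_matAbarAvg'_vecPE_perc p _ (nobleXiT_one_le_blocks p)

/-- The same bound for the real-valued coefficient `Ξ^{(1)}_p = (Ξ^{(1)})^T.toReal` of the lace expansion.
[cite: FitznerVanDerHofstad2017, Lemma 5.2 / §6.1 (6.5) with p. 59 (arXiv:1506.07977v2 pp. 50, 58–59)] -/
theorem tsum_ofReal_nobleXiN_one_le_avg (p : unitInterval) :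
    ∑' x, ENNReal.ofReal (nobleXiN d p 1 x) ≤ vecPS (Letters.perc d p) ᵥ*
      matAbarAvg (unitVecs d) (fun a : Fin 3 => decide (a = 1)) (blockAbar' (Letters.perc d p)) ⬝ᵥ
        vecPE (Letters.perc d p) :=
  tsum_le_vecPS_matAbarAvg'_vecPE_perc p _ fun x => ENNReal.ofReal_toReal_le.trans (nobleXiT_one_le_blocks p x)

end Literature.Probability.FitznerVanDerHofstad2017

end
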